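import Literature.Computation.Certificates.SumOfSquares

/-!
# Packed rational rows: `List ℚ` / `List (List ℚ)` / `SOS.Poly` data shipped as ONE natural per row

Compute-infrastructure file (certnum L4; gridfusion PROSPECT RQ-019 «packed ℚ row decoder def»,
2026-08-27). Client DATA modules of the SOS lanes hold large rational tables — Gram rows
`Q : List (List ℚ)` (gridfusion #50's 189-block: 35 721 entries, ≈ 1.0 MB of `(a : ℚ)/b :: …` text,
≈ 1.5 ms gate elaboration per entry) and polynomial term lists `SOS.Poly = List (Monomial × ℚ)`
(partial sums, 1.16 MB). Natural-number LITERALS elaborate in time independent of the data they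
carry (measured: 187 KB of hex numerals in ≈ 2 s), and the kernel reads fields out of them with
GMP-backed `Nat` division / modulus. This file fixes a byte format and its DECODER DEFINITIONS, so
that a client writes `def blk_Q : List (List ℚ) := PackedQ.decodeRows 189 blk_Qpacked` and every
consumer (`SOS.GramL.Q`, `PSD.closeRangeP`, `matrixOfRows`, the `Poly` merges) takes the decoded
rows DEFINITIONALLY — no soundness lemma is involved: the certified statement quantifies over the
decoded rows, whatever the numerals were; an independent replayer decodes the same bytes the same
way (format below; producer/decoder twin `packedq.py`).

FORMAT `ratrow/1` (one natural per ROW, fields little-endian from the least-significant end,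
exactly `cnt` entries peeled per row): `entry := TAG ‖ |num| ‖ den` with `TAG` = 16 bits
(`bit 0` = sign, `bits 1–7` = `Ln` = byte length of `|num|`, `bits 8–15` = `Ld` = byte length of
`den`, `Ld = 0` meaning `den = 1` with no den field), `|num|` in `Ln` bytes, `den` in `Ld` bytes;
value `mkRat (±|num|) den` (a malformed `den = 0` decodes to `0`, harmlessly). A zero entry is two
zero bytes; trailing zero entries of a row vanish into the numeral's (absent) leading zeros and still
decode as `0` because exactly `cnt` entries are peeled.
FORMAT `ratpoly/1` (one natural per CHUNK of `cnt` terms): `term := Lm ‖ e₁ … e_Lm ‖ entry` with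
`Lm` = 1 byte (number of exponents), each exponent one byte — the `Monomial` list VERBATIM (trimmed
or not, as the emitter's other literals have it), then the coefficient as a `ratrow/1` entry.
Measured (farm, 2026-08-27, rows of #50's 189-block `Q`, real heights): bytes × 0.64 (18.4 B per
entry vs 28.7); ELABORATION 0.09 ms per entry vs 1.55 ms for `(a : ℚ)/b` list literals (80 × 189
entries: 3.3 s vs 24.5 s); KERNEL decoding ≈ 0.5 ms per entry per `decide` that forces the rows
(the text literal's own kernel reduction ≈ 0.15 ms) — a net win whenever the rows are forced in
fewer than ≈ 4 kernel passes (gridfusion: closeness + partial sums = 2); splitting a row into several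
smaller numerals does NOT reduce the kernel cost (27-entry chunks: × 1.9 slower). [folklore]

WHAT THIS FILE DOES NOT CERTIFY: anything — it defines decoders; a statement about decoded rows is
exactly as strong as the same statement about the literal rows. Not a compression scheme with any
optimality claim; byte-granular by design (kernel `Nat` ops on byte-aligned fields).
-/

namespace Literature.Computation.Certificates

namespace PackedQ

open SOS

/-- Decode ONE `ratrow/1` entry from the low end of `R`: `(value, rest)` (byte-field Kronecker
packing). [cite: Harvey2009, §3.1] -/
def decodeEntry (R : ℕ) : ℚ × ℕ :=
  let T := R % 65536
  let Ln := (T / 2) % 128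
  let Ld := T / 256
  let R₁ := R / 65536
  let a := R₁ % 2 ^ (8 * Ln)
  let R₂ := R₁ / 2 ^ (8 * Ln)
  let d := if Ld = 0 then 1 else R₂ % 2 ^ (8 * Ld)
  let R₃ := if Ld = 0 then R₂ else R₂ / 2 ^ (8 * Ld)
  (mkRat (if T % 2 = 1 then -(a : ℤ) else (a : ℤ)) d, R₃)

/-- Decode exactly `cnt` entries of a `ratrow/1` row numeral (missing data decodes as zeros).
[folklore] -/
def decodeRow : ℕ → ℕ → List ℚ
  | 0, _ => []
  | cnt + 1, R => (decodeEntry R).1 :: decodeRow cnt (decodeEntry R).2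

/-- Decode a table: one `ratrow/1` numeral per row, `cnt` entries each (`List.map`, so the row
SPINE is available without decoding any entry). [folklore] -/
def decodeRows (cnt : ℕ) (Rs : List ℕ) : List (List ℚ) := Rs.map (decodeRow cnt)

/-- Decode `Lm` exponent bytes from the low end of `R`: `(exponents, rest)`. [folklore] -/
def decodeExps : ℕ → ℕ → Monomial × ℕ
  | 0, R => ([], R)
  | k + 1, R => ((R % 256) :: (decodeExps k (R / 256)).1, (decodeExps k (R / 256)).2)

/-- Decode ONE `ratpoly/1` term from the low end of `R`: `((monomial, coefficient), rest)`.
[folklore] -/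
def decodeTerm (R : ℕ) : (Monomial × ℚ) × ℕ :=
  let Lm := R % 256
  let er := decodeExps Lm (R / 256)
  let cr := decodeEntry er.2
  ((er.1, cr.1), cr.2)

/-- Decode exactly `cnt` terms of a `ratpoly/1` chunk numeral. [folklore] -/
def decodeTerms : ℕ → ℕ → Poly
  | 0, _ => []
  | cnt + 1, R => (decodeTerm R).1 :: decodeTerms cnt (decodeTerm R).2

/-- Decode a polynomial shipped in CHUNKS `[(cnt₀, R₀), (cnt₁, R₁), …]` (term lists concatenated
in order; chunking keeps every numeral below a byte budget). [folklore] -/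
def decodePoly : List (ℕ × ℕ) → Poly
  | [] => []
  | (cnt, R) :: rest => decodeTerms cnt R ++ decodePoly rest

/-- A decoded row has exactly `cnt` entries (fixed-count field peeling of a Kronecker-packed
numeral). [cite: Harvey2009, §3.1] -/
theorem length_decodeRow (cnt R : ℕ) : (decodeRow cnt R).length = cnt := by
  induction cnt generalizing R with
  | zero => rfl
  | succ c ih => simp [decodeRow, ih]

/-- A decoded table has one row per numeral, each of length `cnt`. [cite: Harvey2009, §3.1] -/
theorem length_decodeRows (cnt : ℕ) (Rs : List ℕ) :
    (decodeRows cnt Rs).length = Rs.length ∧ ∀ r ∈ decodeRows cnt Rs, r.length = cnt := by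
  refine ⟨by simp [decodeRows], fun r hr => ?_⟩
  simp only [decodeRows, List.mem_map] at hr
  obtain ⟨R, _, rfl⟩ := hr
  exact length_decodeRow cnt R

/-- A decoded chunk has exactly `cnt` terms. [cite: Harvey2009, §3.1] -/
theorem length_decodeTerms (cnt R : ℕ) : (decodeTerms cnt R).length = cnt := by
  induction cnt generalizing R with
  | zero => rfl
  | succ c ih => simp [decodeTerms, ih]

/-! ### Kernel examples (the byte layout, decided) -/

/-- `ratrow/1` of the row `[3/4, 0, -5, 22/7]` (encoder `packedq.enc_row`): TAGs `0x0102`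
(+, Ln 1, Ld 1), `0x0000`, `0x0003` (−, Ln 1), `0x0102`; decoded with `cnt = 4`, and with
`cnt = 6` (two phantom zeros). -/
example : decodeRow 4 0x7160102050003000004030102 = [3 / 4, 0, -5, 22 / 7] := by decide +kernel

example : decodeRow 6 0x7160102050003000004030102 = [3 / 4, 0, -5, 22 / 7, 0, 0] := by decide +kernel

/-- A two-row table. -/
example : decodeRows 2 [0x3010102, 0x10002070003] = [[1 / 3, 0], [-7, 1]] := by decide +kernel

/-- `ratpoly/1` of `3/2·x₀²x₂ − x₁` on three variables (monomials `[2, 0, 1]` and `[0, 1]` — the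
second one TRIMMED, exactly as given to the encoder). -/
example : decodeTerms 2 0x100030100020203010201000203 = [([2, 0, 1], 3 / 2), ([0, 1], -1)] := by
  decide +kernel

example : decodePoly [(1, 0x2030102020102), (1, 0x10003010002)] = [([1, 2], 3 / 2), ([0, 1], -1)] := by
  decide +kernel

/-! ### Index-SALTED decoders — use these (KERNEL HASH LAW; APPEND 2026-08-27, certnum-sdp-3 g7)

Lean hashes a natural-number literal by its LOW 64 BITS (`instHashableNat : hash n := UInt64.ofNat n`,
reached through `Lean.Literal.hash` by the structural hash of every kernel term containing the literal),
and the kernel memoises weak-head normal forms in hash tables keyed by that structural hash. Two DISTINCT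
row numerals that agree modulo `2^64` — for `ratrow/1`: two rows whose first ≈ 4 entries coincide, e.g.
rows of a sparse table that START WITH ZEROS (a zero entry is the two bytes `00 00`) — therefore put every
decoding work term built over them (`decodeEntry R`, `(decodeEntry R).2`, `decodeRow k (…)`, all the GMP
`div` / `mod` nodes) into one collision class, and every cache probe degrades to a linear scan with
structural comparison of nested suffix terms: cost QUARTIC in the class size. MEASURED (farm, one
`decide +kernel` forcing every entry via the sum of all entries, 2026-08-27): `60` rows × `60` entries,
dense random rows (60 distinct residues mod `2^64`) 3.8 s; the SAME shape with every row starting with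
twelve zeros (ONE residue class of 60) **220.7 s**; `150 × 150`: 19.9 s dense versus **> 900 s** (farm
timeout) zero-led. The decoders below thread the ROW INDEX (resp. CHUNK INDEX) into the term through the
identity `saltN i R := R`: the kernel work terms of different rows then hash differently whatever the
bytes (zero-led `60 × 60`: **3.1 s**), and `decodeRowsI_eq` / `decodePolyI_eq` say the decoded VALUES are
exactly those of `decodeRows` / `decodePoly`, so nothing stated about a decoded table changes. Clients:
`def blk_Q : List (List ℚ) := PackedQ.decodeRowsI 189 0 blk_Qpacked` (start index `0`; give different
tables of one file different start indices, e.g. `1000·k`, if their numerals may collide across tables),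
`def p : SOS.Poly := PackedQ.decodePolyI 0 chunks`. The unsalted `decodeRows` / `decodePoly` stay for
tables whose numerals are known pairwise distinct modulo `2^64` (dense Gram blocks: gridfusion `#50`'s
189-block rows are all distinct — the 0.5 ms/entry figure of the header was measured there). -/

/-- Index-carrying identity on naturals: `saltN i R` unfolds to `R` in one step, but the TERM mentions
`i`, so kernel terms built over `saltN i R` and `saltN i' R'` never share a hash class when `i ≠ i'`.
[folklore] -/
def saltN (_i R : ℕ) : ℕ := R

/-- `saltN` is the identity. [folklore] -/
@[simp] private theorem saltN_eq (i R : ℕ) : saltN i R = R := rfl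

/-- **`ratrow/1` table decoder, index-salted**: row `k` of `Rs` (counting from the start index `i`)
is decoded as `decodeRow cnt (saltN (i + k) R)`. Same values as `decodeRows cnt Rs` (`decodeRowsI_eq`);
immune to the literal hash law. [cite: Harvey2009, §3.1] -/
def decodeRowsI (cnt : ℕ) : ℕ → List ℕ → List (List ℚ)
  | _, [] => []
  | i, R :: Rs => decodeRow cnt (saltN i R) :: decodeRowsI cnt (i + 1) Rs

/-- The salted table decoder computes exactly `decodeRows`. [cite: Harvey2009, §3.1] -/
theorem decodeRowsI_eq (cnt : ℕ) : ∀ (i : ℕ) (Rs : List ℕ), decodeRowsI cnt i Rs = decodeRows cnt Rs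
  | _, [] => by simp [decodeRowsI, decodeRows]
  | i, R :: Rs => by
      rw [decodeRowsI, decodeRowsI_eq cnt (i + 1) Rs]
      simp [decodeRows, saltN]

/-- A salted-decoded table has one row per numeral, each of length `cnt`. [cite: Harvey2009, §3.1] -/
theorem length_decodeRowsI (cnt i : ℕ) (Rs : List ℕ) :
    (decodeRowsI cnt i Rs).length = Rs.length ∧ ∀ r ∈ decodeRowsI cnt i Rs, r.length = cnt := by
  rw [decodeRowsI_eq]
  exact length_decodeRows cnt Rs

/-- **`ratpoly/1` polynomial decoder, index-salted**: chunk `k` (from the start index `i`) is decoded as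
`decodeTerms cnt (saltN (i + k) R)`. Same values as `decodePoly` (`decodePolyI_eq`). [cite: Harvey2009, §3.1] -/
def decodePolyI : ℕ → List (ℕ × ℕ) → Poly
  | _, [] => []
  | i, (cnt, R) :: rest => decodeTerms cnt (saltN i R) ++ decodePolyI (i + 1) rest

/-- The salted polynomial decoder computes exactly `decodePoly`. [cite: Harvey2009, §3.1] -/
theorem decodePolyI_eq : ∀ (i : ℕ) (chunks : List (ℕ × ℕ)), decodePolyI i chunks = decodePoly chunks
  | _, [] => by simp [decodePolyI, decodePoly]
  | i, (cnt, R) :: rest => by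
      rw [decodePolyI, decodePolyI_eq (i + 1) rest, decodePoly, saltN]

/-- Kernel example: the salted table decoder on the header's two rows (start index `0`). -/
example : decodeRowsI 2 0 [0x3010102, 0x10002070003] = [[1 / 3, 0], [-7, 1]] := by decide +kernel

/-- Kernel example: a start index is arbitrary (here `1000`) — the values do not depend on it. -/
example : decodeRowsI 2 1000 [0x3010102, 0x10002070003] = decodeRows 2 [0x3010102, 0x10002070003] :=
  decodeRowsI_eq ..

/-- Kernel example: the salted polynomial decoder on the header's two chunks. -/
example : decodePolyI 0 [(1, 0x2030102020102), (1, 0x10003010002)] = [([1, 2], 3 / 2), ([0, 1], -1)] := by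
  decide +kernel

end PackedQ

end Literature.Computation.Certificates
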